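import Literature.NumberTheory.EllipticCurves.Sprung2012.LocalTowerTraceProofs
import Literature.NumberTheory.EllipticCurves.Sprung2012.ColemanMapLambdaActionProofs
import Literature.NumberTheory.EllipticCurves.Sprung2012.LocalTowerNoPTorsionProofs
import HarnessLib

/-!
# Sprung 2012, Thm. 2.2 at level `2`: the Honda relations as linear RELATIONS among the orbit values of a functional
# on `E(k_2)` (plus: the local layer degree `pⁿ` from a lift of the generator; coefficient extraction mod `ω_n`) —
# proofs only (part 1 of 2; part 2 `HondaLevelTwoDualCoordinatesProofs.lean` = the generation clauses in coordinates)

Topic `Literature/NumberTheory/EllipticCurves`, cluster `Sprung2012` (namespace = path). A THEOREMS file (no definition,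
no named fact; net Literature debt `0`). Cell `bsd-ssimc`, width seat `cruxlead-stmt-BirchSwinnertonDyer-19875-w3` (gen 7),
lane «(IND) discharge»: the point-independence clause `hind` of
`Sprung2012/ColemanMapJointCokernelProofs.lean` (`forall_exists_isColemanPair_X_mul_rat`, w2 g8) — the ONE input of the
cokernel half of (SES-KP) `0 → H¹_Iw(T) → Λ² → ℤ_p → 0` (Kurihara–Pollack 2007 Prop. 1.2 / Lei–Sujatha 2021 §3) not supplied
by the tree's `IsHondaSystem` — is discharged in the sequel `Sprung2012/ColemanMapJointCokernelIndependenceProofs.lean` from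
the named fact `silvermanVII63_localLayerPoints_finiteIndex_zpLattice` (Silverman AEC VII Prop. 6.3: `E(k_2) ⊇ ℤ_p^{p²}` of
finite index). THIS file (part 1) is the relation bookkeeping of F. E. I. Sprung, *Iwasawa theory for elliptic curves at
supersingular primes: A pair of main conjectures*, J. Number Theory **132** (2012) [Sprung2012], Thm. 2.2 (p. 1487: the
Honda system `c_n`, «as a `ℤ_p[G_n]`-module, `F_ss(𝔪_n)` is generated by `c_n` and `c_{n−1}`», relations (1) (2)) and
Cor. 2.10 (p. 1489) at level `n = 2`, in the tree's functional model (`ColemanMaps.lean`: `IsHondaSystem`, `pairingSum`,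
`evalOn`).

## The mathematics

Let `g` be a local lift of the topological generator, `(c₋₁, c)` a Honda system with `p ∣ a_p`, and `z` an additive map on a
subgroup `A ⊇ E(K_2·K_v)` of local points. Its ORBIT VALUES `x_j = z(gʲc_2)` (`j < p²`), `y_j = z(gʲc_1)` satisfy
* (R-i) `y_j = y_{j mod p}` (`c_1` has level `1`: `g^{p}c_1 = c_1`);
* (R-ii) `∑_{i<p} x_{r+pi} = a_p·y_r − (a_p − 2)·z(c₋₁)` (`Tr_{2/1}c_2 = a_p c_1 − c_0`, `c_0 = (a_p−2)c₋₁`, `g^r` applied);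
* (R-iii) `(a_p(a_p−2) − (p−1))·z(c₋₁) = ∑_{k<p} y_k` (`Tr_{1/0}c_1 = a_p c_0 − (p−1)c₋₁`), where
  `u = a_p(a_p−2) − (p−1) ≡ 1 (mod p)` is a unit of `ℤ_p`;
so the `p²` FREE COORDINATES `(y_r)_{r<p}`, `(x_{r+pi})_{r<p, i<p−1}` determine all orbit values (part 2 reads the level-`2`
generation clauses of `IsHondaSystem` in these coordinates). Also here: the coefficient extraction «`ω_n ∣ ∑_{j<pⁿ} d_j(1+T)ʲ ⇒
d = 0`» (`eq_zero_of_toIwasawa_cyclotomicOmega_dvd_sum`; Weierstrass division by the distinguished `ω_n`, Washington Prop. 7.2),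
and the local layer `K_n·K_v` has degree `[Γ_{K_v} : Gal(K̄_v/K_n·K_v)] = pⁿ` as soon as `Γ_{K_v}` contains a lift of the
topological generator (`index_localLayerSubgroupOfEmb_eq_pow_of_isTopGenerator`; the prime is then totally ramified in the
tower). Nothing here needs `K = ℚ`, `p` odd or any torsion hypothesis; nothing about Selmer groups or BSD is asserted.

## References
* [Sprung2012] F. E. I. Sprung, J. Number Theory 132 (2012) 1483–1506: Thm. 2.2, Lemma 2.3, Cor. 2.10 (pp. 1487–1489);
  Def. 3.1 (p. 1489); Lemmas 7.4–7.5 (p. 1500).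
* [Washington1997] L. C. Washington, *Introduction to Cyclotomic Fields*, Prop. 7.2, §13.1.
* [KuriharaPollack2007] M. Kurihara, R. Pollack, Prop. 1.2. [LeiSujatha2021] A. Lei, R. Sujatha, §3 (SES-KP).
* Tree: `Sprung2012/{ColemanMaps, LocalTowerTraceProofs, ColemanMapLambdaActionProofs, LocalTowerNoPTorsionProofs}.lean`.
-/

noncomputable section

open scoped Classical

open Polynomial Finset

universe u

namespace Literature.NumberTheory.EllipticCurves.Sprung2012

open Literature.NumberTheory.EllipticCurves Literature.NumberTheory.GaloisRepresentations ZpExtension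
  Literature.NumberTheory.EllipticCurves.Kobayashi2003 Literature.NumberTheory.EllipticCurves.Sprung2017

/-! ## §0 Arithmetic in `ℤ_p`: the Honda unit `u = a_p(a_p − 2) − (p − 1)` -/

section Unit

variable {p : ℕ} [Fact p.Prime]

/-- Units of `ℤ_p` are the elements not divisible by `p`. [folklore] -/
private theorem isUnit_iff_not_dvd {a : ℤ_[p]} : IsUnit a ↔ ¬ (p : ℤ_[p]) ∣ a := by
  rw [PadicInt.isUnit_iff, ← PadicInt.norm_lt_one_iff_dvd, not_lt, le_antisymm_iff,
    and_iff_right (PadicInt.norm_le_one a)]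

/-- **The Honda unit**: for `p ∣ a_p`, `u = a_p(a_p − 2) − (p − 1) ≡ 1 (mod p)` is a unit of `ℤ_p` (the scalar by which
`Tr_{1/0} c_1 = a_p c_0 − (p−1) c₋₁ = u·c₋₁`, Sprung Thm. 2.2 (1)–(2)). [cite: Sprung2012, Thm. 2.2 (p. 1487)] -/
theorem isUnit_hondaUnit {ap : ℤ} (hap : (p : ℤ) ∣ ap) :
    IsUnit (((ap * (ap - 2) - ((p : ℤ) - 1) : ℤ) : ℤ_[p])) := by
  rw [isUnit_iff_not_dvd]
  intro h
  have h1 : (p : ℤ_[p]) ^ 1 ∣ ((ap * (ap - 2) - ((p : ℤ) - 1) : ℤ) : ℤ_[p]) := by rwa [pow_one]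
  rw [PadicInt.pow_p_dvd_int_iff 1, pow_one] at h1
  have h2 : (p : ℤ) ∣ 1 := by
    have e : (1 : ℤ) = (ap * (ap - 2) - ((p : ℤ) - 1)) - ap * (ap - 2) + p := by ring
    rw [e]
    exact dvd_add (dvd_sub h1 (dvd_mul_of_dvd_left hap _)) dvd_rfl
  have hp : (p : ℤ).natAbs = 1 := Int.eq_one_of_dvd_one (Int.natCast_nonneg p) h2 |>.symm ▸ rfl
  exact (Fact.out : p.Prime).one_lt.ne' (by simpa using hp)

end Unit

/-! ## §1 The local layer degrees from a lift of the topological generator -/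

section Index

variable {K : Type u} [Field K] {p : ℕ} [Fact p.Prime] (κ : ZpExtension K p)
variable {E : Type u} [Field E] [Algebra K E] (ι : AlgebraicClosure K →ₐ[K] AlgebraicClosure E)

/-- **`[Γ_{K_v} : Gal(K̄_v/K_n·K_v)] = pⁿ` when `Γ_{K_v}` contains a lift `g` of the topological generator** (`κ(res g) = 1`):
the image `κ(res Γ_{K_v}) ⊆ ℤ_p` is `ℤ_p`-stable (`ZpExtension.exists_toAdd_kappa_resGalOfEmb_eq_mul`) and contains `1`, so
`κ ∘ res` is onto and the local layer subgroup, the preimage of `pⁿℤ_p`, has index `[ℤ_p : pⁿℤ_p] = pⁿ` — the local field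
`K_n·K_v` has degree `pⁿ` over `K_v` (total ramification in the local tower; for `K = ℚ`, `κ` cyclotomic: `[ℚ_{p,n} : ℚ_p] =
pⁿ`, Sprung 2012 §2 / Lemma 2.3 «rank `pⁿ`»). [cite: Sprung2012, §2 (p. 1486) and Lemma 2.3 (p. 1488)]
[cite: Washington1997, §13.1] -/
theorem index_localLayerSubgroupOfEmb_eq_pow_of_isTopGenerator {g : Field.absoluteGaloisGroup E}
    (hg : κ.IsTopGenerator (resGalOfEmb ι g)) (n : ℕ) :
    (localLayerSubgroupOfEmb κ ι n).index = p ^ n := by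
  have hsurj : Function.Surjective
      (κ.toContinuousMonoidHom.toMonoidHom.comp (resGalOfEmb ι).toMonoidHom) := by
    intro t
    obtain ⟨τ, hτ⟩ := ZpExtension.exists_toAdd_kappa_resGalOfEmb_eq_mul κ ι t.toAdd g
    have hg1 : (κ (resGalOfEmb ι g)).toAdd = 1 := by
      rw [show κ (resGalOfEmb ι g) = Multiplicative.ofAdd 1 from hg, toAdd_ofAdd]
    rw [hg1, mul_one] at hτ
    exact ⟨τ, Multiplicative.toAdd.injective hτ⟩
  rw [localLayerSubgroupOfEmb, localSubgroupOfEmb, ZpExtension.layerSubgroup, Subgroup.comap_comap,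
    Subgroup.index_comap_of_surjective _ hsurj, ZpExtension.index_toSubgroup_span_pow]

end Index

/-! ## §2 Coefficient extraction modulo `ω_n` -/

section Omega

variable {p : ℕ} [Fact p.Prime]

/-- **`ω_n ∣ ∑_{j<pⁿ} d_j (1+T)ʲ` in `Λ` forces `d_j = 0` for all `j < pⁿ`**: `Λ/ω_n = ℤ_p[T]/ω_n` is `ℤ_p`-free on the classes
of `(1+T)ʲ`, `j < pⁿ` (`= ℤ_p[Γ_n]`; Weierstrass division by the distinguished polynomial `ω_n` of degree `pⁿ`, Washington
Prop. 7.2 — tree `omega_dvd_of_coe_dvd` — then a polynomial of degree `< pⁿ` divisible by `ω_n` vanishes, and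
`T ↦ T − 1` is an automorphism). This is how congruences `(a, b) ≡ (P_{n,c_n}(y), P_{n,c_{n−1}}(y)) (mod ω_n)` of the
generation clauses (Sprung Thm. 2.2 / Cor. 2.10, `Λ_n = ℤ_p[G_n]`) are read coefficientwise.
[cite: Washington1997, Prop. 7.2] [cite: Sprung2012, Cor. 2.10 (p. 1489)] -/
theorem eq_zero_of_toIwasawa_cyclotomicOmega_dvd_sum {n : ℕ} (d : ℕ → ℤ_[p])
    (h : toIwasawa p (cyclotomicOmega p n) ∣
      ∑ j ∈ range (p ^ n), PowerSeries.C (d j) * (1 + PowerSeries.X) ^ j) {j : ℕ} (hj : j < p ^ n) :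
    d j = 0 := by
  have hp : p.Prime := Fact.out
  -- the polynomials `q = ∑ d_j Xʲ` and `taylor 1 q = ∑ d_j (X+1)ʲ`
  set q : ℤ_[p][X] := ∑ i ∈ range (p ^ n), monomial i (d i) with hq
  have hr : ((taylor 1 q : ℤ_[p][X]) : PowerSeries ℤ_[p]) =
      ∑ j ∈ range (p ^ n), PowerSeries.C (d j) * (1 + PowerSeries.X) ^ j := by
    rw [hq, map_sum, ← Polynomial.coeToPowerSeries.ringHom_apply, map_sum]
    refine sum_congr rfl fun j _ => ?_
    rw [taylor_monomial, Polynomial.coeToPowerSeries.ringHom_apply, Polynomial.coe_mul, Polynomial.coe_pow,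
      Polynomial.coe_C, Polynomial.coe_add, Polynomial.coe_X, Polynomial.coe_C, map_one, add_comm]
  -- `ω_n ∣ taylor 1 q` in `ℤ_p[X]`
  have hdvd : ((X + 1 : ℤ_[p][X]) ^ p ^ n - 1) ∣ taylor 1 q := by
    apply omega_dvd_of_coe_dvd
    rw [← toIwasawa_cyclotomicOmega_eq_coe, hr]
    exact h
  -- degrees: `deg (taylor 1 q) = deg q < pⁿ = deg ω_n`
  have hω : ((X + 1 : ℤ_[p][X]) ^ p ^ n - 1).natDegree = p ^ n := by
    have hX1 : (X + 1 : ℤ_[p][X]).natDegree = 1 := by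
      rw [← Polynomial.C_1, Polynomial.natDegree_X_add_C]
    have hpow : ((X + 1 : ℤ_[p][X]) ^ p ^ n).natDegree = p ^ n := by
      rw [Polynomial.natDegree_pow, hX1, mul_one]
    rw [Polynomial.natDegree_sub_eq_left_of_natDegree_lt, hpow]
    rw [hpow, Polynomial.natDegree_one]
    exact pow_pos hp.pos n
  have hdeg : (taylor 1 q).natDegree < ((X + 1 : ℤ_[p][X]) ^ p ^ n - 1).natDegree := by
    rw [Polynomial.natDegree_taylor, hω]
    have hle : q.natDegree ≤ p ^ n - 1 := by
      rw [hq]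
      refine Polynomial.natDegree_sum_le_of_forall_le _ _ fun i hi => ?_
      have hi' := mem_range.mp hi
      exact (Polynomial.natDegree_monomial_le _).trans (by omega)
    have hpos := pow_pos hp.pos n
    omega
  have hzero : taylor 1 q = 0 := Polynomial.eq_zero_of_dvd_of_natDegree_lt hdvd hdeg
  rw [taylor_apply, Polynomial.comp_X_add_C_eq_zero_iff] at hzero
  have hcoeff := congrArg (fun f : ℤ_[p][X] => f.coeff j) hzero
  simp only [hq, finsetSum_coeff, coeff_monomial, sum_ite_eq', mem_range, hj, if_true, coeff_zero] at hcoeff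
  exact hcoeff

end Omega

/-! ## §3 The Honda relations at levels `0, 1, 2` as relations among orbit values -/

section Relations

variable {K : Type u} [Field K] {p : ℕ} [Fact p.Prime] (κ : ZpExtension K p)
variable {E : Type u} [Field E] [Algebra K E] (ι : AlgebraicClosure K →ₐ[K] AlgebraicClosure E)
variable (W : WeierstrassCurve K)

/-- A functional extended by zero is additive on its subgroup (plumbing). [folklore] -/
private theorem evalOn_add_of_mem (A : AddSubgroup (localPoints W E)) (z : A →+ ℤ_[p])
    {P Q : localPoints W E} (hP : P ∈ A) (hQ : Q ∈ A) :
    evalOn W A z (P + Q) = evalOn W A z P + evalOn W A z Q := by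
  rw [evalOn_of_mem W A z (add_mem hP hQ), evalOn_of_mem W A z hP, evalOn_of_mem W A z hQ, ← map_add]
  rfl

/-- A functional extended by zero is subtractive on its subgroup (plumbing). [folklore] -/
private theorem evalOn_sub_of_mem (A : AddSubgroup (localPoints W E)) (z : A →+ ℤ_[p])
    {P Q : localPoints W E} (hP : P ∈ A) (hQ : Q ∈ A) :
    evalOn W A z (P - Q) = evalOn W A z P - evalOn W A z Q := by
  rw [evalOn_of_mem W A z (sub_mem hP hQ), evalOn_of_mem W A z hP, evalOn_of_mem W A z hQ, ← map_sub]
  rfl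

/-- A functional extended by zero commutes with `ℤ`-multiples on its subgroup (plumbing). [folklore] -/
private theorem evalOn_zsmul_of_mem (A : AddSubgroup (localPoints W E)) (z : A →+ ℤ_[p])
    {P : localPoints W E} (hP : P ∈ A) (k : ℤ) :
    evalOn W A z (k • P) = (k : ℤ_[p]) * evalOn W A z P := by
  rw [evalOn_of_mem W A z (zsmul_mem hP k), evalOn_of_mem W A z hP, ← zsmul_eq_mul, ← map_zsmul]
  rfl

/-- A functional extended by zero is additive over finite sums inside its subgroup (plumbing). [folklore] -/
private theorem evalOn_finset_sum_of_mem (A : AddSubgroup (localPoints W E)) (z : A →+ ℤ_[p])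
    {α : Type*} (s : Finset α) (P : α → localPoints W E) (hP : ∀ a ∈ s, P a ∈ A) :
    evalOn W A z (∑ a ∈ s, P a) = ∑ a ∈ s, evalOn W A z (P a) := by
  classical
  induction s using Finset.induction_on with
  | empty =>
    rw [sum_empty, sum_empty, evalOn_of_mem W A z A.zero_mem]
    exact map_zero z
  | insert a s ha ih =>
    rw [sum_insert ha, sum_insert ha,
      evalOn_add_of_mem W A z (hP a (mem_insert_self a s)) (A.sum_mem fun b hb => hP b (mem_insert_of_mem hb)),
      ih fun b hb => hP b (mem_insert_of_mem hb)]

variable {κ ι W}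

/-- **(R-i) as points: the `g`-orbit of a level-`1` point is `p`-periodic**, `gʲ•y = g^{j mod p}•y` for `y ∈ E(K_1·K_v)`
(`g^{p} ∈ Gal(K̄_v/K_1·K_v)`). [cite: Sprung2012, §2 (p. 1486) (Γ_n = Gal(k_∞/k_n))] -/
theorem pow_smul_eq_pow_mod_smul_of_mem_layer_one {g : Field.absoluteGaloisGroup E}
    (hg : κ.IsTopGenerator (resGalOfEmb ι g)) {y : localPoints W E} (hy : y ∈ localLayerPointsOfEmb κ ι W 1) (j : ℕ) :
    g ^ j • y = g ^ (j % p) • y := by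
  conv_lhs => rw [← Nat.mod_add_div j p, pow_add, mul_smul]
  have h := pow_mul_smul_of_mem_localLayerPointsOfEmb κ ι W hg hy (j / p)
  rw [pow_one] at h
  rw [h]

/-- **(R-iii) as points: `∑_{k<p} gᵏ•c_1 = (a_p(a_p−2) − (p−1))•c₋₁`** — Thm. 2.2 (1)–(2): `Tr_{1/0} c_1 = a_p c_0 − (p−1)c₋₁`,
`c_0 = (a_p−2)c₋₁`, the trace being the orbit sum over `gᵏ`, `k < p`. [cite: Sprung2012, Thm. 2.2 (1)–(2) (p. 1487)] -/
theorem sum_pow_smul_honda_one_eq {ap : ℤ} {g : Field.absoluteGaloisGroup E} (hg : κ.IsTopGenerator (resGalOfEmb ι g))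
    {cneg : localPoints W E} {c : ℕ → localPoints W E} (hH : IsHondaSystem κ ι W ap g cneg c) :
    ∑ k ∈ range p, g ^ k • c 1 = (ap * (ap - 2) - ((p : ℤ) - 1)) • cneg := by
  obtain ⟨-, hcn, hc0, htr1, -⟩ := hH
  have h := localTraceOfEmb_succ_eq_sum_pow_smul κ ι W hg 0 (hcn 1)
  simp only [pow_zero, one_mul, zero_add] at h
  rw [← h, htr1, hc0, smul_smul, ← sub_smul]

/-- **(R-ii) as points: `∑_{i<p} g^{r+pi}•c_2 = a_p•(gʳ•c_1) − (a_p−2)•c₋₁`** — Thm. 2.2 (1): `Tr_{2/1} c_2 = a_p c_1 − c_0`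
(orbit sum over `g^{pi}`, `i < p`), translated by `gʳ`; `c_0 = (a_p − 2)c₋₁` is `Γ`-fixed. [cite: Sprung2012, Thm. 2.2 (1)–(2) (p. 1487)] -/
theorem sum_pow_smul_honda_two_eq {ap : ℤ} {g : Field.absoluteGaloisGroup E} (hg : κ.IsTopGenerator (resGalOfEmb ι g))
    {cneg : localPoints W E} {c : ℕ → localPoints W E} (hH : IsHondaSystem κ ι W ap g cneg c) (r : ℕ) :
    ∑ i ∈ range p, g ^ (r + p * i) • c 2 = ap • (g ^ r • c 1) - (ap - 2) • cneg := by
  obtain ⟨hcneg, hcn, hc0, -, htrn, -⟩ := hH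
  have h := localTraceOfEmb_succ_eq_sum_pow_smul κ ι W hg 1 (hcn 2)
  have h1 := htrn 1 le_rfl
  simp only [pow_one, Nat.sub_self] at h h1
  rw [h1, hc0] at h
  -- apply `gʳ`
  have h2 := congrArg (fun P : localPoints W E => g ^ r • P) h
  simp only [smul_sum, ← mul_smul, ← pow_add, smul_sub] at h2
  rw [← h2, smul_comm (g ^ r) ap (c 1), smul_comm (g ^ r) (ap - 2) cneg,
    (mem_localLayerPointsOfEmb_zero_iff κ ι W cneg).mp hcneg (g ^ r)]

variable {A : AddSubgroup (localPoints W E)}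

/-- Memberships: the orbits of `c_2`, `c_1` and the point `c₋₁` lie in any `A ⊇ E(K_2·K_v)` (plumbing).
[cite: Sprung2012, Thm. 2.2 (p. 1487)] -/
theorem honda_orbit_mem (hA : localLayerPointsOfEmb κ ι W 2 ≤ A) {ap : ℤ} {g : Field.absoluteGaloisGroup E}
    {cneg : localPoints W E} {c : ℕ → localPoints W E} (hH : IsHondaSystem κ ι W ap g cneg c) :
    (∀ j : ℕ, g ^ j • c 2 ∈ A) ∧ (∀ j : ℕ, g ^ j • c 1 ∈ A) ∧ cneg ∈ A := by
  obtain ⟨hcneg, hcn, -⟩ := hH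
  refine ⟨fun j => hA (smul_mem_localLayerPointsOfEmb κ ι W 2 _ (hcn 2)),
    fun j => hA (localLayerPointsOfEmb_mono κ ι W (by norm_num : 1 ≤ 2) (smul_mem_localLayerPointsOfEmb κ ι W 1 _ (hcn 1))),
    hA (localLayerPointsOfEmb_mono κ ι W (Nat.zero_le 2) hcneg)⟩

/-- **(R-i) for functionals: `z(gʲc_1) = z(g^{j mod p}c_1)`.** [cite: Sprung2012, Thm. 2.2 (p. 1487)] -/
theorem evalOn_pow_smul_honda_one {ap : ℤ} {g : Field.absoluteGaloisGroup E} (hg : κ.IsTopGenerator (resGalOfEmb ι g))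
    {cneg : localPoints W E} {c : ℕ → localPoints W E} (hH : IsHondaSystem κ ι W ap g cneg c) (z : A →+ ℤ_[p]) (j : ℕ) :
    evalOn W A z (g ^ j • c 1) = evalOn W A z (g ^ (j % p) • c 1) := by
  rw [pow_smul_eq_pow_mod_smul_of_mem_layer_one hg (hH.2.1 1) j]

/-- **(R-iii) for functionals: `u·z(c₋₁) = ∑_{k<p} z(gᵏc_1)`**, `u = a_p(a_p−2) − (p−1)`, for an additive `z` on any
`A ⊇ E(K_2·K_v)`. [cite: Sprung2012, Thm. 2.2 (1)–(2) (p. 1487)] -/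
theorem hondaUnit_mul_evalOn_cneg (hA : localLayerPointsOfEmb κ ι W 2 ≤ A) {ap : ℤ} {g : Field.absoluteGaloisGroup E}
    (hg : κ.IsTopGenerator (resGalOfEmb ι g)) {cneg : localPoints W E} {c : ℕ → localPoints W E}
    (hH : IsHondaSystem κ ι W ap g cneg c) (z : A →+ ℤ_[p]) :
    ((ap * (ap - 2) - ((p : ℤ) - 1) : ℤ) : ℤ_[p]) * evalOn W A z cneg = ∑ k ∈ range p, evalOn W A z (g ^ k • c 1) := by
  obtain ⟨-, hc1A, hcnegA⟩ := honda_orbit_mem hA hH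
  rw [← evalOn_zsmul_of_mem W A z hcnegA, ← sum_pow_smul_honda_one_eq hg hH,
    evalOn_finset_sum_of_mem W A z _ _ fun k _ => hc1A k]

/-- **(R-ii) for functionals: `∑_{i<p} z(g^{r+pi}c_2) = a_p·z(gʳc_1) − (a_p−2)·z(c₋₁)`** for an additive `z` on any
`A ⊇ E(K_2·K_v)`. [cite: Sprung2012, Thm. 2.2 (1)–(2) (p. 1487)] -/
theorem sum_evalOn_pow_smul_honda_two (hA : localLayerPointsOfEmb κ ι W 2 ≤ A) {ap : ℤ} {g : Field.absoluteGaloisGroup E}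
    (hg : κ.IsTopGenerator (resGalOfEmb ι g)) {cneg : localPoints W E} {c : ℕ → localPoints W E}
    (hH : IsHondaSystem κ ι W ap g cneg c) (z : A →+ ℤ_[p]) (r : ℕ) :
    ∑ i ∈ range p, evalOn W A z (g ^ (r + p * i) • c 2) =
      (ap : ℤ_[p]) * evalOn W A z (g ^ r • c 1) - ((ap - 2 : ℤ) : ℤ_[p]) * evalOn W A z cneg := by
  obtain ⟨hc2A, hc1A, hcnegA⟩ := honda_orbit_mem hA hH
  rw [← evalOn_finset_sum_of_mem W A z _ _ fun i _ => hc2A _, sum_pow_smul_honda_two_eq hg hH r,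
    evalOn_sub_of_mem W A z (zsmul_mem (hc1A r) _) (zsmul_mem hcnegA _), evalOn_zsmul_of_mem W A z (hc1A r),
    evalOn_zsmul_of_mem W A z hcnegA]

end Relations

end Literature.NumberTheory.EllipticCurves.Sprung2012

end
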